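import Literature.Geometry.Lorentzian.KerrConvergence
import Literature.Geometry.Lorentzian.KerrSchildEnergyEstimate
import Literature.Geometry.Lorentzian.KerrWaveDecay
import Literature.Geometry.Lorentzian.BilinPullbackEstimates
import Mathlib.Analysis.Calculus.ContDiff.Bounds
import HarnessLib

/-!
# Gluing toolbox for the gap certificate, II: rest-frame bookkeeping and the interpolating self-map
# (crux `StarvedNecks.NeckGapDecay`, stmt-FinalStateConjecture-16768, line `Sketch`, packaging stub P-glue `stub_certOfCoreFrom`)

Rest-frame coordinates of a motion `(Λ, c)`: `z = Λ⁻¹(x − c)` (`poincareInv`), rest time `t = z⁰`, Euclidean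
rest norm `s = ‖z⃗‖` (`E4.spatialNorm`), Kerr–Schild rest radius `r` (`Kerr.radius a z`).  We record the
Lipschitz bookkeeping `|t(y) − t(x)|, |s(y) − s(x)| ≤ ‖Λ⁻¹‖ ‖y − x‖`, the comparison `r ≤ s ≤ r + |a|`,
membership in the boosted Kerr exterior from `r > 2M`, convexity/openness of late half-spaces, and the
pointwise `C³` bounds of the interpolation field `P = χ·(T − id)` of the belt construction
(`S = id + P`): Leibniz on the collar where `T − id` is `C³`-small, identically zero off the cut-off shell.

References: O'Neill 1983, Ch. 9 (Lorentz/Poincaré maps); Visser arXiv:0706.0622, (35) (Kerr–Schild radius).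
No new definitions.
-/

noncomputable section

open scoped Manifold ContDiff Topology ENNReal
open Filter Set Function Topology Literature.Geometry.Lorentzian

namespace Summit.FinalStateConjecture.FinalStateConjecture.Theorems.NeckGapDecay.ConnectionLevelCones.Glue

set_option linter.dupNamespace false

/-! ## Rest-frame bookkeeping -/

section RestFrame

variable (Λ : lorentzGroup) (c : E4)

/-- `poincareInv` is affine: `Λ⁻¹(y − c) − Λ⁻¹(x − c) = Λ⁻¹(y − x)`. [folklore] -/
theorem poincareInv_sub (x y : E4) :
    poincareInv Λ c y - poincareInv Λ c x = (Λ : E4 ≃L[ℝ] E4).symm (y - x) := by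
  simp only [poincareInv, ← map_sub, sub_sub_sub_cancel_right]

/-- `‖Λ⁻¹(y − c) − Λ⁻¹(x − c)‖ ≤ ‖Λ⁻¹‖ ‖y − x‖`. [folklore] -/
theorem norm_poincareInv_sub_le (x y : E4) :
    ‖poincareInv Λ c y - poincareInv Λ c x‖ ≤ ‖((Λ : E4 ≃L[ℝ] E4).symm : E4 →L[ℝ] E4)‖ * ‖y - x‖ := by
  rw [poincareInv_sub]
  exact ((Λ : E4 ≃L[ℝ] E4).symm : E4 →L[ℝ] E4).le_opNorm (y - x)

/-- Rest time is `‖Λ⁻¹‖`-Lipschitz: `|t(y) − t(x)| ≤ ‖Λ⁻¹‖ ‖y − x‖`. [folklore] -/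
theorem abs_time_sub_le (x y : E4) :
    |poincareInv Λ c y 0 - poincareInv Λ c x 0| ≤ ‖((Λ : E4 ≃L[ℝ] E4).symm : E4 →L[ℝ] E4)‖ * ‖y - x‖ := by
  have h1 : |poincareInv Λ c y 0 - poincareInv Λ c x 0| ≤ ‖poincareInv Λ c y - poincareInv Λ c x‖ := by
    have h := PiLp.norm_apply_le (poincareInv Λ c y - poincareInv Λ c x) 0
    rwa [PiLp.sub_apply, Real.norm_eq_abs] at h
  exact h1.trans (norm_poincareInv_sub_le Λ c x y)

/-- The Euclidean rest norm is `‖Λ⁻¹‖`-Lipschitz: `|s(y) − s(x)| ≤ ‖Λ⁻¹‖ ‖y − x‖`. [folklore] -/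
theorem abs_spatialNorm_sub_le (x y : E4) :
    |E4.spatialNorm (poincareInv Λ c y) - E4.spatialNorm (poincareInv Λ c x)| ≤
      ‖((Λ : E4 ≃L[ℝ] E4).symm : E4 →L[ℝ] E4)‖ * ‖y - x‖ := by
  have h1 : |E4.spatialNorm (poincareInv Λ c y) - E4.spatialNorm (poincareInv Λ c x)| ≤
      ‖poincareInv Λ c y - poincareInv Λ c x‖ := by
    unfold E4.spatialNorm
    refine (abs_norm_sub_norm_le _ _).trans ?_
    rw [← map_sub]
    exact E4.spatialNorm_le_norm _
  exact h1.trans (norm_poincareInv_sub_le Λ c x y)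

/-- Rest time and rest norm are continuous. [folklore] -/
theorem continuous_time : Continuous fun x : E4 ↦ poincareInv Λ c x 0 :=
  (PiLp.continuous_apply 2 _ 0).comp (continuous_poincareInv Λ c)

/-- The Euclidean rest norm is continuous. [folklore] -/
theorem continuous_spatialNorm : Continuous fun x : E4 ↦ E4.spatialNorm (poincareInv Λ c x) :=
  (continuous_norm.comp E4.spatial.continuous).comp (continuous_poincareInv Λ c)

/-- The late half-space `{x | τ < t(x)}` is open. [folklore] -/
theorem isOpen_setOf_lt_time (τ : ℝ) : IsOpen {x : E4 | τ < poincareInv Λ c x 0} :=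
  isOpen_lt continuous_const (continuous_time Λ c)

/-- The late half-space `{x | τ < t(x)}` is convex (`t` is affine). [folklore] -/
theorem convex_setOf_lt_time (τ : ℝ) : Convex ℝ {x : E4 | τ < poincareInv Λ c x 0} := by
  set ℓ : E4 →L[ℝ] ℝ := (EuclideanSpace.proj (0 : Fin 4)).comp ((Λ : E4 ≃L[ℝ] E4).symm : E4 →L[ℝ] E4)
    with hℓ
  have hℓapp : ∀ x : E4, ℓ x = (Λ : E4 ≃L[ℝ] E4).symm x 0 := fun x ↦ rfl
  have hset : {x : E4 | τ < poincareInv Λ c x 0} = ℓ ⁻¹' Ioi (τ + ℓ c) := by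
    ext x
    simp only [mem_setOf_eq, mem_preimage, mem_Ioi, hℓapp, poincareInv, map_sub, PiLp.sub_apply]
    constructor <;> intro h <;> linarith
  rw [hset]
  exact (convex_Ioi _).linear_preimage ℓ.toLinearMap

end RestFrame

/-! ## Radius comparisons and membership in the boosted exterior -/

section Radius

/-- `‖z⃗‖ ≤ r_a(z) + |a|` (from `‖z⃗‖² − a² ≤ r²`); private copy of
`…Theorems.NecksCertifyBargmann.Seam.spatialNorm_le_kerr_radius_add_abs` (not imported: heavy module). [folklore] -/
private theorem spatialNorm_le_radius_add_abs (a : ℝ) (z : E4) : E4.spatialNorm z ≤ Kerr.radius a z + |a| := by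
  have h := Kerr.spatialNorm_sq_sub_sq_le_radius_sq a z
  have hr := Kerr.radius_nonneg a z
  have hs : 0 ≤ E4.spatialNorm z := norm_nonneg _
  have h1 : E4.spatialNorm z ^ 2 ≤ (Kerr.radius a z + |a|) ^ 2 := by
    rw [← sq_abs a] at h
    nlinarith [abs_nonneg a]
  exact (sq_le_sq₀ hs (by positivity)).mp h1

/-- `r₊(M, a) ≤ 2M` for `0 ≤ M`; private copy of `…Theorems.NecksCertify.Negative.rPlus_le_two_mul` (not imported:
heavy module). [folklore] -/
private theorem rPlus_le_two_mul {M : ℝ} (hM : 0 ≤ M) (a : ℝ) : Kerr.rPlus M a ≤ 2 * M := by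
  unfold Kerr.rPlus
  have h1 : √(M ^ 2 - a ^ 2) ≤ √(M ^ 2) := Real.sqrt_le_sqrt (by nlinarith [sq_nonneg a])
  rw [Real.sqrt_sq hM] at h1
  linarith

/-- A lab point whose rest radius exceeds `2M` lies in the boosted Kerr exterior (`r₊ ≤ 2M`). [folklore] -/
theorem mem_domain_of_two_mul_lt_radius (Λ : lorentzGroup) (c : E4) {M : ℝ} (hM : 0 ≤ M) (a : ℝ) {y : E4}
    (hy : 2 * M < Kerr.radius a (poincareInv Λ c y)) : y ∈ (boostedKerrBackground Λ c M a).domain := by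
  show y ∈ boostedKerrExterior Λ c M a
  rw [mem_boostedKerrExterior, Kerr.mem_exterior]
  exact max_lt ((rPlus_le_two_mul hM a).trans_lt hy) ((mul_nonneg zero_le_two hM).trans_lt hy)

/-- A lab point whose Euclidean rest norm exceeds `2M + |a|` lies in the boosted Kerr exterior. [folklore] -/
theorem mem_domain_of_lt_spatialNorm (Λ : lorentzGroup) (c : E4) {M : ℝ} (hM : 0 ≤ M) (a : ℝ) {y : E4}
    (hy : 2 * M + |a| < E4.spatialNorm (poincareInv Λ c y)) : y ∈ (boostedKerrBackground Λ c M a).domain :=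
  mem_domain_of_two_mul_lt_radius Λ c hM a
    (by linarith [spatialNorm_le_radius_add_abs a (poincareInv Λ c y)])

end Radius

/-! ## The interpolation field `P = χ·(T − id)`: pointwise `C³` bounds -/

section Field

variable {χ : E4 → ℝ} {T : E4 → E4}

/-- **Leibniz bound**: if `‖Dʲχ(x)‖ ≤ G` and `‖Dʲ(T − id)(x)‖ ≤ e` for `j ≤ 3`, then
`‖Dʲ(χ·(T − id))(x)‖ ≤ 8 G e` for `j ≤ 3`. [folklore] -/
theorem norm_iteratedFDeriv_smul_sub_le {χ : E4 → ℝ} {T : E4 → E4} (hχ : ContDiff ℝ ∞ χ)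
    (hT : ContDiff ℝ ∞ T) {G e : ℝ} (hG : 0 ≤ G) (he : 0 ≤ e) {x : E4}
    (hχb : ∀ j, j ≤ 3 → ‖iteratedFDeriv ℝ j χ x‖ ≤ G)
    (hTb : ∀ j, j ≤ 3 → ‖iteratedFDeriv ℝ j (fun y ↦ T y - y) x‖ ≤ e) {j : ℕ} (hj : j ≤ 3) :
    ‖iteratedFDeriv ℝ j (fun y ↦ χ y • (T y - y)) x‖ ≤ 8 * G * e := by
  have hV : ContDiff ℝ ∞ (fun y ↦ T y - y) := hT.sub contDiff_id
  have key := norm_iteratedFDeriv_smul_le hχ hV x (n := j) (by exact_mod_cast (le_top : (j : ℕ∞) ≤ ⊤))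
  refine key.trans ?_
  have hterm : ∀ i ∈ Finset.range (j + 1),
      (j.choose i : ℝ) * ‖iteratedFDeriv ℝ i χ x‖ * ‖iteratedFDeriv ℝ (j - i) (fun y ↦ T y - y) x‖ ≤
        (j.choose i : ℝ) * (G * e) := by
    intro i hi
    have hi' : i ≤ j := Nat.lt_succ_iff.mp (Finset.mem_range.mp hi)
    rw [mul_assoc]
    exact mul_le_mul_of_nonneg_left
      (mul_le_mul (hχb i (hi'.trans hj)) (hTb (j - i) (by omega)) (norm_nonneg _) hG) (by positivity)
  refine (Finset.sum_le_sum hterm).trans ?_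
  rw [← Finset.sum_mul]
  have h2 : ∑ i ∈ Finset.range (j + 1), (j.choose i : ℝ) = 2 ^ j := by exact_mod_cast Nat.sum_range_choose j
  rw [h2]
  have h3 : (2 : ℝ) ^ j ≤ 8 := by
    interval_cases j <;> norm_num
  nlinarith [mul_nonneg hG he]

/-- The field vanishes where the cut-off does, with norm `≤ e` where `‖T x − x‖ ≤ e` (`0 ≤ χ ≤ 1`). [folklore] -/
theorem norm_smul_sub_le (hχ01 : ∀ x, 0 ≤ χ x ∧ χ x ≤ 1) {e : ℝ} {x : E4} (hx : χ x = 0 ∨ ‖T x - x‖ ≤ e)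
    (he : 0 ≤ e) : ‖χ x • (T x - x)‖ ≤ e := by
  rcases hx with h | h
  · rw [h, zero_smul, norm_zero]; exact he
  · rw [norm_smul, Real.norm_eq_abs, abs_of_nonneg (hχ01 x).1]
    exact (mul_le_of_le_one_left (norm_nonneg _) (hχ01 x).2).trans h

/-- Off the support of the cut-off (an open condition), the field is locally zero, so all its derivatives
vanish there. [folklore] -/
theorem iteratedFDeriv_smul_sub_eq_zero {U : Set E4} (hU : IsOpen U) (hχU : ∀ y ∈ U, χ y = 0) {x : E4}
    (hx : x ∈ U) (j : ℕ) : iteratedFDeriv ℝ j (fun y ↦ χ y • (T y - y)) x = 0 := by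
  have h : (fun y ↦ χ y • (T y - y)) =ᶠ[𝓝 x] fun _ ↦ (0 : E4) := by
    filter_upwards [hU.mem_nhds hx] with y hy
    rw [hχU y hy, zero_smul]
  rw [(h.iteratedFDeriv ℝ j).eq_of_nhds, iteratedFDeriv_fun_zero]
  rfl

/-- `‖DP(x)‖ = ‖D¹P(x)‖`. [folklore] -/
theorem norm_fderiv_eq_norm_iteratedFDeriv_one (P : E4 → E4) (x : E4) :
    ‖fderiv ℝ P x‖ = ‖iteratedFDeriv ℝ 1 P x‖ := by
  rw [← norm_iteratedFDeriv_fderiv, norm_iteratedFDeriv_zero]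

end Field

end Summit.FinalStateConjecture.FinalStateConjecture.Theorems.NeckGapDecay.ConnectionLevelCones.Glue
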